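import Literature.Analysis.FluidPDE.KNSSTypeIRateMild
import Literature.Analysis.FluidPDE.KNSSTypeIRateLiouvilleMild
import Literature.Analysis.FluidPDE.KNSSBlowupLimit
import Literature.Analysis.FluidPDE.HolderExtraction
import Literature.Analysis.FluidPDE.OseenMildHolder
import Literature.Analysis.FluidPDE.OseenDuhamelLimits
import Literature.Analysis.FluidPDE.GigaMiura2011ScaledAlignmentBlowupLimitHolds
import Literature.Analysis.FluidPDE.BlowupAncientSolution
import HarnessLib

/-!
# KNSS 2009, Lemma 6.1 (compactness of uniformly bounded mild solutions), rate-free, over mild data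

Analysis/FluidPDE proofs file (theorems only). Koch–Nadirashvili–Seregin–Šverák, *Liouville
theorems for the Navier–Stokes equations and applications*, Acta Math. 203 (2009) 83–105 =
arXiv:0709.3599, **Lemma 6.1**, p. 11:

> "Assume that `u_l` is a sequence of bounded mild solutions of Navier–Stokes defined in
> `ℝⁿ × (T_l, 0)` (for some initial data) with a uniform bound `|u_l| ≤ C`, and `T_l ↘ −∞`. Then we
> can choose a subsequence such that along the subsequence the `u_l` converge locally uniformly in
> `ℝⁿ × (−∞, 0)` to an ancient mild solution `u` satisfying `|u| ≤ C`. This is an easy consequence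
> of the results in Section 4."

The tree held this compactness step only in the Type-I dress of the proof of Theorem 6.2
(`KNSS2009_typeI_rate_mildCompactness_holds`, `KNSSTypeIRateMildCompactnessProofs`: the bound
`√(−τ)‖w⁽ᵏ⁾‖ ≤ C`). This file proves the lemma AS PRINTED — with a UNIFORM bound `‖w⁽ᵏ⁾‖ ≤ N` on
`(A_k, 0]` — by the same argument (uniform `1/4`-Hölder modulus of bounded Oseen-mild solutions
on the slab pieces `[−(n+2), −1/(n+2)] × B̄(0, n+2)`, `exists_holder_quarter_of_oseenMild`; the
diagonal Arzelà–Ascoli extraction `exists_strictMono_tendstoUniformlyOn_of_bound`; dominated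
convergence in the divergence constraint and in the Oseen identity,
`tendsto_heatExtension_of_tendsto_of_bound`, `tendsto_oseenDuhamel_of_tendsto_of_bound`), over
mild data (the Oseen integral equation of each `w⁽ᵏ⁾` between all times of `(A_k, B_k)` is a
hypothesis, as in the Type-I file), and packages the limit in the tree's classes:

* `KNSS2009_lemma61_of_oseenMild` — **Lemma 6.1, rate-free**: a subsequence converges slice-wise
  locally uniformly at every `t < 0` to a jointly continuous `W` on `(−∞, 0) × ℝ³` with weakly
  divergence-free slices, `‖W‖ ≤ N`, satisfying the Oseen integral equation between all
  `s < t < 0`;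
* `KNSS2009_lemma61_ancientMild_of_oseenMild` — the limit is a **bounded ancient mild solution in
  the duality class** (`IsBoundedAncientMildSolution 1 W`, by `isBoundedAncientMildSolution_of_oseen`)
  which is **smooth on the open slab with all derivatives bounded** (KNSS §4 for bounded ancient
  Oseen-mild fields, `smooth_and_bounds_of_bounded_ancient_oseenMild`);
* `isKNSSBlowupLimit_of_oseenMild_zoom` — with `N = 1` and near-maximal values persisting at some
  negative time along the sequence (the normalisation of KNSS's Proposition 6.1, made a
  hypothesis: `∀ ε > 0, ∃ s < 0, ∃ y, ∀ᶠ k, 1 − ε < ‖w⁽ᵏ⁾(s, y)‖`), the limit is a KNSS blow-up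
  limit (`IsKNSSBlowupLimit`): the extraction of Proposition 6.1 WITH its mode of convergence;
* `isKNSSBlowupLimit_of_oseenMild_zoom_vertex` (appended) — the same with the persistence
  hypothesis DERIVED from `‖w⁽ᵏ⁾‖ ≤ 1` up to the vertex time and `‖w⁽ᵏ⁾(0, 0)‖ → 1` (the printed
  normalisation), by the uniform Hölder modulus in time of bounded Oseen-mild solutions.

## References

* G. Koch, N. Nadirashvili, G. Seregin, V. Šverák, Acta Math. 203 (2009) 83–105 =
  arXiv:0709.3599: Lemma 6.1 and Proposition 6.1 (p. 11), §4 (p. 8), proof of Thm 6.2 (p. 13).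
  [KochNadirashviliSereginSverak2009]
* P. G. Lemarié-Rieusset, *The Navier–Stokes problem in the 21st century*, CRC 2016, Thm. 6.1
  (Oseen-mild ⇒ duality-form mild). [LemarieRieusset2016]
-/

noncomputable section

open MeasureTheory Set Function Filter TopologicalSpace Metric
open _root_.Topology
open scoped RealInnerProductSpace NNReal ENNReal

namespace Literature.Analysis.FluidPDE

/-- **KNSS 2009, Lemma 6.1, rate-free, over mild data** (Acta Math. 203 (2009) = arXiv:0709.3599,
Lemma 6.1, p. 11: a sequence of mild solutions on `ℝ³ × (T_l, 0)`, `T_l ↘ −∞`, with a UNIFORM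
bound has a subsequence converging locally uniformly in `ℝ³ × (−∞, 0)` to an ancient mild
solution with the same bound). Given classical solutions `w⁽ᵏ⁾` (`ν = 1`) on `ℝ³ × (A_k, B_k)`,
`A_k → −∞`, `B_k > 0`, satisfying the Oseen integral equation between all times of `(A_k, B_k)`
and the uniform bound `‖w⁽ᵏ⁾(τ, x)‖ ≤ N` for `A_k < τ < 0`, a subsequence converges, slice-wise
locally uniformly at every negative time, to a jointly continuous `W` on `(−∞, 0) × ℝ³` with weakly
divergence-free slices, `‖W‖ ≤ N`, satisfying the Oseen integral equation between all
`s < t < 0`. Proof = that of `KNSS2009_typeI_rate_mildCompactness_holds` with the uniform bound in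
place of the Type-I bound. [cite: KochNadirashviliSereginSverak2009, Lemma 6.1 (arXiv p. 11)] -/
theorem KNSS2009_lemma61_of_oseenMild {N : ℝ} {A B : ℕ → ℝ}
    {w : ℕ → ℝ → EuclideanSpace ℝ (Fin 3) → EuclideanSpace ℝ (Fin 3)}
    {q : ℕ → ℝ → EuclideanSpace ℝ (Fin 3) → ℝ} (hN : 0 ≤ N)
    (hAlim : Tendsto A atTop atBot) (hBpos : ∀ k, 0 < B k)
    (hw : ∀ k, IsClassicalNSSolutionOn (Ioo (A k) (B k)) 1 0 (w k) (q k))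
    (hmildAB : ∀ k, ∀ s t : ℝ, A k < s → s < t → t < B k → ∀ x,
      w k t x = UnboundedOperators.heatExtension (w k s) (t - s) x - oseenDuhamel 1 s (w k) (w k) t x)
    (hbd : ∀ k, ∀ τ ∈ Ioo (A k) 0, ∀ x, ‖w k τ x‖ ≤ N) :
    ∃ (φ : ℕ → ℕ) (W : ℝ → EuclideanSpace ℝ (Fin 3) → EuclideanSpace ℝ (Fin 3)), StrictMono φ ∧
      ContinuousOn (uncurry W) (Iio 0 ×ˢ univ) ∧
      (∀ t < 0, IsWeaklyDivFree (W t)) ∧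
      (∀ t < 0, ∀ x, ‖W t x‖ ≤ N) ∧
      (∀ s t : ℝ, s < t → t < 0 → ∀ x,
        W t x = UnboundedOperators.heatExtension (W s) (t - s) x - oseenDuhamel 1 s W W t x) ∧
      (∀ t < 0, TendstoLocallyUniformly (fun k => w (φ k) t) (W t) atTop) := by
  -- ## Step 1: per-`k` facts
  have hcont : ∀ k, ContinuousOn (uncurry (w k)) (Ioo (A k) (B k) ×ˢ univ) := fun k =>
    (hw k).smooth_velocity.continuousOn
  have hslice : ∀ k, ∀ t ∈ Ioo (A k) (B k), Continuous (w k t) := fun k t ht =>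
    (hcont k).comp_continuous (Continuous.prodMk_right t) fun x => ⟨ht, mem_univ x⟩
  have hbdd : ∀ k, ∀ τ ∈ Ioo (A k) 0, ∀ x, ‖w k τ x‖ ≤ N := hbd
  -- the Oseen identity between negative times is part of the data (`t < 0 < B k`)
  have hmild : ∀ k, ∀ s t : ℝ, A k < s → s < t → t < 0 → ∀ x,
      w k t x = UnboundedOperators.heatExtension (w k s) (t - s) x -
        oseenDuhamel 1 s (w k) (w k) t x :=
    fun k s t hAs hst ht0 x => hmildAB k s t hAs hst (ht0.trans (hBpos k)) x
  -- ## Step 2: the uniform Hölder modulus on the slab pieces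
  obtain ⟨K₀, hK₀, hHold⟩ := exists_holder_quarter_of_oseenMild (E := (EuclideanSpace ℝ (Fin 3)))
  set R : ℕ → ℝ := fun _ => N with hR
  have hR0 : ∀ n, 0 ≤ R n := fun _ => hN
  set V : ℕ → ℝ × (EuclideanSpace ℝ (Fin 3)) → (EuclideanSpace ℝ (Fin 3)) :=
    fun k z => w k z.1 z.2 with hV
  set T : ℕ → Set (ℝ × (EuclideanSpace ℝ (Fin 3))) := fun n =>
    Icc (-((n : ℝ) + 2)) (-(1 / ((n : ℝ) + 2))) ×ˢ
      closedBall (0 : (EuclideanSpace ℝ (Fin 3))) ((n : ℝ) + 2) with hT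
  have hVn : ∀ n : ℕ, ∀ᶠ k in atTop, ContinuousOn (V k) (T n) ∧
      (∀ z ∈ T n, ‖V k z‖ ≤ R n) ∧
      ∀ z ∈ T n, ∀ z' ∈ T n,
        dist (V k z) (V k z') ≤ K₀ * (R n + R n ^ 2) * dist z z' ^ (1 / 4 : ℝ) := by
    intro n
    have hn2 : (0 : ℝ) < (n : ℝ) + 2 := by positivity
    have hδ : (0 : ℝ) < 1 / ((n : ℝ) + 2) := by positivity
    filter_upwards [hAlim.eventually (eventually_lt_atBot (-((n : ℝ) + 3)))] with k hk
    set a : ℝ := -((n : ℝ) + 3) with ha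
    set b : ℝ := -(1 / ((n : ℝ) + 2)) with hb
    have hb0 : b < 0 := by rw [hb]; linarith
    have hIcc : ∀ t ∈ Icc a b, t ∈ Ioo (A k) (B k) := fun t ht =>
      ⟨hk.trans_le ht.1, (ht.2.trans_lt hb0).trans (hBpos k)⟩
    have hIcc0 : ∀ t ∈ Icc a b, t ∈ Ioo (A k) 0 := fun t ht =>
      ⟨hk.trans_le ht.1, ht.2.trans_lt hb0⟩
    have hbR : ∀ t ∈ Icc a b, ∀ x, ‖w k t x‖ ≤ R n := fun t ht x => hbdd k t (hIcc0 t ht) x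
    have hmod := hHold (hR0 n) (fun t ht => hslice k t (hIcc t ht)) hbR
      (fun s t has hst htb x => hmild k s t (hk.trans_le has) hst (htb.trans_lt hb0) x)
    have hpiece : ∀ z ∈ T n, z.1 ∈ Icc (a + 1) b := fun z hz => by
      obtain ⟨⟨h1, h2⟩, -⟩ := mem_slabPiece.1 hz
      exact ⟨by rw [ha]; linarith, by rw [hb]; exact h2⟩
    refine ⟨?_, fun z hz => ?_, fun z hz z' hz' => ?_⟩
    · refine (hcont k).mono fun z hz => ⟨?_, mem_univ _⟩
      have h := hpiece z hz
      exact hIcc z.1 ⟨by linarith [h.1], h.2⟩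
    · have h := hpiece z hz
      exact hbR z.1 ⟨by linarith [h.1], h.2⟩ z.2
    · have h := hmod z'.1 (hpiece z' hz') z.1 (hpiece z hz) z'.2 z.2
      rw [dist_eq_norm, Prod.dist_eq, Real.dist_eq, dist_eq_norm]
      exact h
  -- ## Step 3: extraction
  obtain ⟨φ, hφ, W₀, hW₀⟩ := exists_strictMono_tendstoUniformlyOn_of_bound
    (fun n => isCompact_slabPiece (E := (EuclideanSpace ℝ (Fin 3))) n) (fun n => by positivity)
    (fun _ => by norm_num) hVn
  have hφt : Tendsto φ atTop atTop := hφ.tendsto_atTop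
  have hθA : Tendsto (fun j => A (φ j)) atTop atBot := hAlim.comp hφt
  set W : ℝ → (EuclideanSpace ℝ (Fin 3)) → (EuclideanSpace ℝ (Fin 3)) := fun t x => W₀ (t, x)
    with hWdef
  have hVφ : ∀ n, ∀ᶠ j in atTop, ContinuousOn (V (φ j)) (T n) := fun n =>
    (hφt.eventually (hVn n)).mono fun j hj => hj.1
  have hWc : ContinuousOn (uncurry W) (Iio 0 ×ˢ univ) := by
    have h := continuousOn_slab_of_tendstoUniformlyOn hVφ hW₀
    exact h.congr fun z _ => rfl
  have hpt : ∀ t < 0, ∀ x, Tendsto (fun j => w (φ j) t x) atTop (𝓝 (W t x)) := fun t ht x =>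
    tendsto_of_tendstoUniformlyOn_slabPiece hW₀ ht x
  have hdom : ∀ t : ℝ, ∀ᶠ j in atTop, A (φ j) < t := fun t =>
    hθA.eventually (eventually_lt_atBot t)
  refine ⟨φ, W, hφ, hWc, fun t ht => ?_, fun t ht x => ?_, fun s t hst ht x => ?_, fun t ht => ?_⟩
  · -- ## Step 4a: weak divergence-freeness of the limit slices
    intro θ hθ
    have hθ1 : ContDiff ℝ 1 θ := contDiff_infty.1 hθ.contDiff 1
    have hgc : HasCompactSupport (gradient θ) := by
      have : gradient θ =
          (fun L => (InnerProductSpace.toDual ℝ (EuclideanSpace ℝ (Fin 3))).symm L) ∘ fderiv ℝ θ :=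
        rfl
      rw [this]
      exact (hθ.hasCompactSupport.fderiv (𝕜 := ℝ)).comp_left (by simp)
    have hθi : Integrable (fun x => N * ‖gradient θ x‖) volume :=
      (((continuous_gradient_of_contDiff hθ1).integrable_of_hasCompactSupport hgc).norm).const_mul N
    have hlimθ : Tendsto (fun j => ∫ x, ⟪w (φ j) t x, gradient θ x⟫) atTop
        (𝓝 (∫ x, ⟪W t x, gradient θ x⟫)) := by
      refine tendsto_integral_filter_of_dominated_convergence (fun x => N * ‖gradient θ x‖)
        ?_ ?_ hθi (Eventually.of_forall fun x => (hpt t ht x).inner tendsto_const_nhds)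
      · filter_upwards [hdom t] with j hj
        exact ((hslice (φ j) t ⟨hj, ht.trans (hBpos _)⟩).inner
          (continuous_gradient_of_contDiff hθ1)).aestronglyMeasurable
      · filter_upwards [hdom t] with j hj
        exact Eventually.of_forall fun x => (norm_inner_le_norm _ _).trans
          (mul_le_mul_of_nonneg_right (hbdd (φ j) t ⟨hj, ht⟩ x) (norm_nonneg _))
    have hzero : ∀ᶠ j in atTop, ∫ x, ⟪w (φ j) t x, gradient θ x⟫ = 0 := by
      filter_upwards [hdom t] with j hj
      have htj : t ∈ Ioo (A (φ j)) (B (φ j)) := ⟨hj, ht.trans (hBpos _)⟩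
      exact VectorCalculus.IsDivFree.isWeaklyDivFree_holds ((hw (φ j)).divFree t htj)
        (contDiff_infty.1 ((hw (φ j)).contDiff_velocity htj) 1) θ hθ
    exact tendsto_nhds_unique hlimθ (tendsto_const_nhds.congr' (hzero.mono fun j hj => hj.symm))
  · -- ## Step 4b: the bound `‖W‖ ≤ N`
    refine le_of_tendsto (hpt t ht x).norm ?_
    filter_upwards [hdom t] with j hj
    exact hbdd (φ j) t ⟨hj, ht⟩ x
  · -- ## Step 5: the Oseen identity in the limit
    have hs0 : s < 0 := hst.trans ht
    obtain ⟨k₀, hk₀⟩ := eventually_atTop.1 (hdom s)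
    set u : ℕ → ℝ → (EuclideanSpace ℝ (Fin 3)) → (EuclideanSpace ℝ (Fin 3)) :=
      fun j => w (φ (j + k₀)) with hu
    have hAu : ∀ j, A (φ (j + k₀)) < s := fun j => hk₀ _ (Nat.le_add_left _ _)
    have hshift : Tendsto (fun j => j + k₀) atTop atTop := tendsto_add_atTop_nat k₀
    have huM : ∀ j, ∀ τ ∈ Ioo s t, ∀ y, ‖u j τ y‖ ≤ N := fun j τ hτ y =>
      hbdd _ τ ⟨(hAu j).trans hτ.1, hτ.2.trans ht⟩ y
    have hum : ∀ j, AEStronglyMeasurable (uncurry (u j))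
        ((volume : Measure (ℝ × (EuclideanSpace ℝ (Fin 3)))).restrict (Ioo s t ×ˢ univ)) :=
      fun j => ((hcont _).mono (prod_mono
        (fun τ hτ => ⟨(hAu j).trans hτ.1, (hτ.2.trans ht).trans (hBpos _)⟩)
          Subset.rfl)).aestronglyMeasurable (measurableSet_Ioo.prod MeasurableSet.univ)
    have hWm : AEStronglyMeasurable (uncurry W)
        ((volume : Measure (ℝ × (EuclideanSpace ℝ (Fin 3)))).restrict (Ioo s t ×ˢ univ)) :=
      (hWc.mono (prod_mono (fun τ hτ => hτ.2.trans ht) Subset.rfl)).aestronglyMeasurable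
        (measurableSet_Ioo.prod MeasurableSet.univ)
    have hptu : ∀ τ < 0, ∀ y, Tendsto (fun j => u j τ y) atTop (𝓝 (W τ y)) := fun τ hτ y =>
      (hpt τ hτ y).comp hshift
    have hD : Tendsto (fun j => oseenDuhamel 1 s (u j) (u j) t x) atTop
        (𝓝 (oseenDuhamel 1 s W W t x)) :=
      tendsto_oseenDuhamel_of_tendsto_of_bound one_pos hN hst hum hWm huM
        (fun τ hτ y => hptu τ (hτ.2.trans ht) y) x
    have hH : Tendsto (fun j => UnboundedOperators.heatExtension (u j s) (t - s) x) atTop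
        (𝓝 (UnboundedOperators.heatExtension (W s) (t - s) x)) := by
      refine tendsto_heatExtension_of_tendsto_of_bound (M := N)
        (fun j => (hslice _ s ⟨hAu j, hs0.trans (hBpos _)⟩).aestronglyMeasurable)
        (fun j z => hbdd _ s ⟨hAu j, hs0⟩ z) (hptu s hs0) (sub_pos.2 hst) x
    have hid : (fun j => u j t x) = fun j =>
        UnboundedOperators.heatExtension (u j s) (t - s) x - oseenDuhamel 1 s (u j) (u j) t x :=
      funext fun j => hmild _ s t (hAu j) hst ht x
    have hlim2 : Tendsto (fun j => u j t x) atTop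
        (𝓝 (UnboundedOperators.heatExtension (W s) (t - s) x - oseenDuhamel 1 s W W t x)) := by
      rw [hid]; exact hH.sub hD
    exact tendsto_nhds_unique (hptu t ht x) hlim2
  · -- ## Step 3': slice-wise locally uniform convergence
    exact tendstoLocallyUniformly_slice_of_tendstoUniformlyOn_slabPiece hW₀ ht

/-- **The Lemma 6.1 limit is a smooth bounded ancient mild solution (duality class).** Under the
hypotheses of `KNSS2009_lemma61_of_oseenMild`, the limit `W` of the extracted subsequence is a
bounded ancient mild solution of Navier–Stokes (`ν = 1`) in the tree's duality class
(`IsBoundedAncientMildSolution 1 W` — Oseen-mild ⇒ duality form,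
`isBoundedAncientMildSolution_of_oseen`), jointly smooth on `(−∞, 0) × ℝ³` with every spatial
derivative bounded (KNSS §4 for bounded ancient Oseen-mild fields,
`smooth_and_bounds_of_bounded_ancient_oseenMild`), with `‖W‖ ≤ N`, and `w⁽ᵠ⁽ᵏ⁾⁾(t) → W(t)` locally
uniformly for every `t < 0`. [cite: KochNadirashviliSereginSverak2009, Lemma 6.1 (arXiv p. 11) with §4 (p. 8)] -/
theorem KNSS2009_lemma61_ancientMild_of_oseenMild {N : ℝ} {A B : ℕ → ℝ}
    {w : ℕ → ℝ → EuclideanSpace ℝ (Fin 3) → EuclideanSpace ℝ (Fin 3)}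
    {q : ℕ → ℝ → EuclideanSpace ℝ (Fin 3) → ℝ} (hN : 0 ≤ N)
    (hAlim : Tendsto A atTop atBot) (hBpos : ∀ k, 0 < B k)
    (hw : ∀ k, IsClassicalNSSolutionOn (Ioo (A k) (B k)) 1 0 (w k) (q k))
    (hmildAB : ∀ k, ∀ s t : ℝ, A k < s → s < t → t < B k → ∀ x,
      w k t x = UnboundedOperators.heatExtension (w k s) (t - s) x - oseenDuhamel 1 s (w k) (w k) t x)
    (hbd : ∀ k, ∀ τ ∈ Ioo (A k) 0, ∀ x, ‖w k τ x‖ ≤ N) :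
    ∃ (φ : ℕ → ℕ) (W : ℝ → EuclideanSpace ℝ (Fin 3) → EuclideanSpace ℝ (Fin 3)), StrictMono φ ∧
      IsBoundedAncientMildSolution 1 W ∧
      ContDiffOn ℝ (⊤ : ℕ∞) (uncurry W) (Iio 0 ×ˢ univ) ∧
      (∀ k : ℕ, ∃ C : ℝ, ∀ t < 0, ∀ x, ‖iteratedFDeriv ℝ k (W t) x‖ ≤ C) ∧
      (∀ t < 0, ∀ x, ‖W t x‖ ≤ N) ∧
      (∀ t < 0, TendstoLocallyUniformly (fun k => w (φ k) t) (W t) atTop) := by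
  obtain ⟨φ, W, hφ, hWc, hdiv, hWbd, hmild, hconv⟩ :=
    KNSS2009_lemma61_of_oseenMild hN hAlim hBpos hw hmildAB hbd
  have hanc : IsBoundedAncientMildSolution 1 W :=
    isBoundedAncientMildSolution_of_oseen one_pos hWc ⟨N, hWbd⟩ hdiv
      (fun s t hst ht x => by rw [one_mul]; exact hmild s t hst ht x)
  obtain ⟨hsm, hder⟩ := smooth_and_bounds_of_bounded_ancient_oseenMild hWc hdiv hmild hWbd
  exact ⟨φ, W, hφ, hanc, hsm, hder, hWbd, hconv⟩

/-- **KNSS 2009, Proposition 6.1 with its mode of convergence** (Acta Math. 203 (2009) =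
arXiv:0709.3599, §6 p. 11: "A finite-time singularity arising from a mild solution generates a
bounded ancient mild solution which is not identically zero", proved there by the zoom-in
`v⁽ᵏ⁾(y, s) = M_k⁻¹ u(x_k + y/M_k, t_k + s/M_k²)` around near-maxima and Lemma 6.1). For a sequence
of classical Oseen-mild solutions on `(A_k, B_k)`, `A_k → −∞`, `B_k > 0`, bounded by `1` on
`(A_k, 0)` (the zoomed fields of the printed proof), whose near-maximal values persist at some
negative time along the sequence (`∀ ε > 0, ∃ s < 0, ∃ y, ∀ᶠ k, 1 − ε < ‖w⁽ᵏ⁾(s, y)‖` — in print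
this follows from the choice `|u(x_k, t_k)| ≥ M_k/2`… and the time-continuity at the vertex; here
it is a hypothesis), a subsequence converges slice-wise locally uniformly to a KNSS blow-up limit
(`IsKNSSBlowupLimit`: smooth bounded ancient mild solution with `|W| ≤ 1 = sup |W|`) — the tree's
`KNSS2009_blowup_generates_ancient` conclusion TOGETHER WITH the convergence of the zoom. [cite: KochNadirashviliSereginSverak2009, Prop 6.1 and Lemma 6.1 (arXiv p. 11)] -/
theorem isKNSSBlowupLimit_of_oseenMild_zoom {A B : ℕ → ℝ}
    {w : ℕ → ℝ → EuclideanSpace ℝ (Fin 3) → EuclideanSpace ℝ (Fin 3)}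
    {q : ℕ → ℝ → EuclideanSpace ℝ (Fin 3) → ℝ}
    (hAlim : Tendsto A atTop atBot) (hBpos : ∀ k, 0 < B k)
    (hw : ∀ k, IsClassicalNSSolutionOn (Ioo (A k) (B k)) 1 0 (w k) (q k))
    (hmildAB : ∀ k, ∀ s t : ℝ, A k < s → s < t → t < B k → ∀ x,
      w k t x = UnboundedOperators.heatExtension (w k s) (t - s) x - oseenDuhamel 1 s (w k) (w k) t x)
    (hbd : ∀ k, ∀ τ ∈ Ioo (A k) 0, ∀ x, ‖w k τ x‖ ≤ 1)
    (hnear : ∀ ε : ℝ, 0 < ε → ∃ s < 0, ∃ y : EuclideanSpace ℝ (Fin 3),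
      ∀ᶠ k in atTop, 1 - ε < ‖w k s y‖) :
    ∃ (φ : ℕ → ℕ) (W : ℝ → EuclideanSpace ℝ (Fin 3) → EuclideanSpace ℝ (Fin 3)), StrictMono φ ∧
      IsKNSSBlowupLimit W ∧
      (∀ t < 0, TendstoLocallyUniformly (fun k => w (φ k) t) (W t) atTop) := by
  obtain ⟨φ, W, hφ, hanc, hsm, -, hWbd, hconv⟩ :=
    KNSS2009_lemma61_ancientMild_of_oseenMild zero_le_one hAlim hBpos hw hmildAB hbd
  have hWc : ContinuousOn (uncurry W) (Iio 0 ×ˢ univ) := hsm.continuousOn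
  refine ⟨φ, W, hφ, ⟨hanc, fun t ht => ?_, ?_, hWbd, fun ε hε => ?_⟩, hconv⟩
  · exact (hWc.comp_continuous (Continuous.prodMk_right t) fun x => ⟨ht, mem_univ x⟩).aestronglyMeasurable
  · simpa using hsm
  · -- near-maximal values persist along the subsequence and pass to the limit
    obtain ⟨s, hs, y, hev⟩ := hnear (ε / 2) (half_pos hε)
    have hpt : Tendsto (fun k => ‖w (φ k) s y‖) atTop (𝓝 ‖W s y‖) :=
      (((hconv s hs).tendstoLocallyUniformlyOn (s := univ)).tendsto_at (mem_univ y)).norm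
    have hge : 1 - ε / 2 ≤ ‖W s y‖ :=
      ge_of_tendsto hpt ((hφ.tendsto_atTop.eventually hev).mono fun k hk => hk.le)
    exact ⟨s, hs, y, by linarith⟩

/-- **KNSS 2009, Proposition 6.1 with its mode of convergence, vertex form** (Acta Math. 203
(2009) = arXiv:0709.3599, §6 p. 11, proof of Prop. 6.1: the zoomed fields are bounded by `1` up
to the vertex time and `|v⁽ᵏ⁾(0, 0)| → 1` by the choice of the centres near the running maxima).
If the classical Oseen-mild solutions `w⁽ᵏ⁾` on `(A_k, B_k)`, `A_k → −∞`, `B_k > 0`, are bounded by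
`1` on `(A_k, 0] × ℝ³` (vertex time INCLUDED) and `‖w⁽ᵏ⁾(0, 0)‖ → 1`, then a subsequence converges
slice-wise locally uniformly to a KNSS blow-up limit (`IsKNSSBlowupLimit`): the near-maximal
values persist at small negative times by the uniform `1/4`-Hölder modulus in time of bounded
Oseen-mild solutions (`exists_holder_quarter_of_oseenMild` on the window `[−2, 0]`), so
`isKNSSBlowupLimit_of_oseenMild_zoom` applies. This is the extraction of Proposition 6.1 with
every hypothesis read off the pre-limit fields. [cite: KochNadirashviliSereginSverak2009, Prop 6.1 and Lemma 6.1 (arXiv p. 11)] -/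
theorem isKNSSBlowupLimit_of_oseenMild_zoom_vertex {A B : ℕ → ℝ}
    {w : ℕ → ℝ → EuclideanSpace ℝ (Fin 3) → EuclideanSpace ℝ (Fin 3)}
    {q : ℕ → ℝ → EuclideanSpace ℝ (Fin 3) → ℝ}
    (hAlim : Tendsto A atTop atBot) (hBpos : ∀ k, 0 < B k)
    (hw : ∀ k, IsClassicalNSSolutionOn (Ioo (A k) (B k)) 1 0 (w k) (q k))
    (hmildAB : ∀ k, ∀ s t : ℝ, A k < s → s < t → t < B k → ∀ x,
      w k t x = UnboundedOperators.heatExtension (w k s) (t - s) x - oseenDuhamel 1 s (w k) (w k) t x)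
    (hbd : ∀ k, ∀ τ ∈ Ioc (A k) 0, ∀ x, ‖w k τ x‖ ≤ 1)
    (hvert : Tendsto (fun k => ‖w k 0 0‖) atTop (𝓝 1)) :
    ∃ (φ : ℕ → ℕ) (W : ℝ → EuclideanSpace ℝ (Fin 3) → EuclideanSpace ℝ (Fin 3)), StrictMono φ ∧
      IsKNSSBlowupLimit W ∧
      (∀ t < 0, TendstoLocallyUniformly (fun k => w (φ k) t) (W t) atTop) := by
  refine isKNSSBlowupLimit_of_oseenMild_zoom hAlim hBpos hw hmildAB
    (fun k τ hτ x => hbd k τ ⟨hτ.1, hτ.2.le⟩ x) fun ε hε => ?_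
  -- the uniform Hölder modulus in time of bounded Oseen-mild solutions
  obtain ⟨K₀, hK₀, hHold⟩ := exists_holder_quarter_of_oseenMild (E := (EuclideanSpace ℝ (Fin 3)))
  -- a small time step `δ ∈ (0, 1]` with `2 K₀ δ^{1/4} < ε / 2`
  obtain ⟨δ, hδ0, hδ1, hδε⟩ : ∃ δ : ℝ, 0 < δ ∧ δ ≤ 1 ∧ K₀ * (1 + 1 ^ 2) * δ ^ (1 / 4 : ℝ) < ε / 2 := by
    have hc : Continuous fun δ : ℝ => K₀ * (1 + 1 ^ 2) * δ ^ (1 / 4 : ℝ) :=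
      continuous_const.mul (Real.continuous_rpow_const (by norm_num))
    have h0 : K₀ * (1 + 1 ^ 2) * (0 : ℝ) ^ (1 / 4 : ℝ) < ε / 2 := by
      rw [Real.zero_rpow (by norm_num), mul_zero]; exact half_pos hε
    have hev : ∀ᶠ δ in 𝓝[>] (0 : ℝ), K₀ * (1 + 1 ^ 2) * δ ^ (1 / 4 : ℝ) < ε / 2 ∧ δ ≤ 1 := by
      refine Filter.Eventually.and ?_ ?_
      · exact nhdsWithin_le_nhds ((hc.tendsto 0).eventually (gt_mem_nhds h0))
      · exact nhdsWithin_le_nhds (eventually_le_nhds one_pos)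
    obtain ⟨δ, ⟨hδa, hδb⟩, hδpos⟩ := (hev.and self_mem_nhdsWithin).exists
    exact ⟨δ, hδpos, hδb, hδa⟩
  refine ⟨-δ, by linarith, 0, ?_⟩
  -- for large `k`: the window `[-2, 0] ⊂ (A k, B k)` and `‖w k 0 0‖ > 1 - ε/2`
  have hk1 : ∀ᶠ k in atTop, A k < -2 := hAlim.eventually (eventually_lt_atBot (-2))
  have hk2 : ∀ᶠ k in atTop, 1 - ε / 2 < ‖w k 0 0‖ :=
    hvert.eventually (lt_mem_nhds (by linarith))
  filter_upwards [hk1, hk2] with k hA hv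
  have hslice : ∀ t ∈ Icc (-2 : ℝ) 0, Continuous (w k t) := fun t ht =>
    (hw k).smooth_velocity.continuousOn.comp_continuous (Continuous.prodMk_right t)
      fun x => ⟨⟨hA.trans_le ht.1, ht.2.trans_lt (hBpos k)⟩, mem_univ x⟩
  have hbR : ∀ t ∈ Icc (-2 : ℝ) 0, ∀ x, ‖w k t x‖ ≤ 1 := fun t ht x =>
    hbd k t ⟨hA.trans_le ht.1, ht.2⟩ x
  have hmild : ∀ s t : ℝ, (-2 : ℝ) ≤ s → s < t → t ≤ 0 → ∀ x,
      w k t x = UnboundedOperators.heatExtension (w k s) (t - s) x - oseenDuhamel 1 s (w k) (w k) t x :=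
    fun s t hs hst ht x => hmildAB k s t (hA.trans_le hs) hst (ht.trans_lt (hBpos k)) x
  have hmod := hHold zero_le_one hslice hbR hmild 0 ⟨by norm_num, le_rfl⟩ (-δ)
    ⟨by norm_num; linarith, by linarith⟩ (0 : EuclideanSpace ℝ (Fin 3)) 0
  have hmax : max |(-δ) - 0| ‖(0 : EuclideanSpace ℝ (Fin 3)) - 0‖ = δ := by
    rw [sub_zero, sub_zero, norm_zero, abs_neg, abs_of_pos hδ0, max_eq_left hδ0.le]
  rw [hmax] at hmod
  -- `‖w k (-δ) 0‖ ≥ ‖w k 0 0‖ − ‖w k (-δ) 0 − w k 0 0‖ > 1 − ε`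
  have htri : ‖w k 0 0‖ ≤ ‖w k (-δ) 0‖ + ‖w k (-δ) 0 - w k 0 0‖ := by
    have := norm_add_le (w k (-δ) 0) (w k 0 0 - w k (-δ) 0)
    rw [add_sub_cancel] at this
    rwa [norm_sub_rev] at this
  linarith

/-- **KNSS 2009, Proposition 6.1 with its mode of convergence, near-vertex form**: as in
`isKNSSBlowupLimit_of_oseenMild_zoom_vertex`, but the near-maximal values `‖w_k(0, y_k)‖ → 1` are
attained at final-time points `y_k → y₀` converging to an arbitrary point (the situation of an
AXIS-centred zoom whose near-maxima sit at bounded distance from the axis, KNSS proof of Thm 6.3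
Case A, arXiv p. 13). The uniform parabolic Hölder modulus of bounded Oseen-mild solutions
(`exists_holder_quarter_of_oseenMild`, in space AND time) transports the near-maximal value to the
fixed point `(−δ, y₀)`, so `isKNSSBlowupLimit_of_oseenMild_zoom` applies. [cite: KochNadirashviliSereginSverak2009, Prop 6.1, Lemma 6.1 and proof of Thm 6.3 (arXiv pp. 11, 13)] -/
theorem isKNSSBlowupLimit_of_oseenMild_zoom_nearVertex {A B : ℕ → ℝ}
    {w : ℕ → ℝ → EuclideanSpace ℝ (Fin 3) → EuclideanSpace ℝ (Fin 3)}
    {q : ℕ → ℝ → EuclideanSpace ℝ (Fin 3) → ℝ}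
    (hAlim : Tendsto A atTop atBot) (hBpos : ∀ k, 0 < B k)
    (hw : ∀ k, IsClassicalNSSolutionOn (Ioo (A k) (B k)) 1 0 (w k) (q k))
    (hmildAB : ∀ k, ∀ s t : ℝ, A k < s → s < t → t < B k → ∀ x,
      w k t x = UnboundedOperators.heatExtension (w k s) (t - s) x - oseenDuhamel 1 s (w k) (w k) t x)
    (hbd : ∀ k, ∀ τ ∈ Ioc (A k) 0, ∀ x, ‖w k τ x‖ ≤ 1)
    {y : ℕ → EuclideanSpace ℝ (Fin 3)} {y₀ : EuclideanSpace ℝ (Fin 3)} (hy : Tendsto y atTop (𝓝 y₀))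
    (hnearpt : Tendsto (fun k => ‖w k 0 (y k)‖) atTop (𝓝 1)) :
    ∃ (φ : ℕ → ℕ) (W : ℝ → EuclideanSpace ℝ (Fin 3) → EuclideanSpace ℝ (Fin 3)), StrictMono φ ∧
      IsKNSSBlowupLimit W ∧
      (∀ t < 0, TendstoLocallyUniformly (fun k => w (φ k) t) (W t) atTop) := by
  refine isKNSSBlowupLimit_of_oseenMild_zoom hAlim hBpos hw hmildAB
    (fun k τ hτ x => hbd k τ ⟨hτ.1, hτ.2.le⟩ x) fun ε hε => ?_
  -- the uniform parabolic Hölder modulus of bounded Oseen-mild solutions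
  obtain ⟨K₀, hK₀, hHold⟩ := exists_holder_quarter_of_oseenMild (E := (EuclideanSpace ℝ (Fin 3)))
  -- a small step `δ ∈ (0, 1]` with `2 K₀ δ^{1/4} < ε / 2`
  obtain ⟨δ, hδ0, hδ1, hδε⟩ : ∃ δ : ℝ, 0 < δ ∧ δ ≤ 1 ∧ K₀ * (1 + 1 ^ 2) * δ ^ (1 / 4 : ℝ) < ε / 2 := by
    have hc : Continuous fun δ : ℝ => K₀ * (1 + 1 ^ 2) * δ ^ (1 / 4 : ℝ) :=
      continuous_const.mul (Real.continuous_rpow_const (by norm_num))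
    have h0 : K₀ * (1 + 1 ^ 2) * (0 : ℝ) ^ (1 / 4 : ℝ) < ε / 2 := by
      rw [Real.zero_rpow (by norm_num), mul_zero]; exact half_pos hε
    have hev : ∀ᶠ δ in 𝓝[>] (0 : ℝ), K₀ * (1 + 1 ^ 2) * δ ^ (1 / 4 : ℝ) < ε / 2 ∧ δ ≤ 1 := by
      refine Filter.Eventually.and ?_ ?_
      · exact nhdsWithin_le_nhds ((hc.tendsto 0).eventually (gt_mem_nhds h0))
      · exact nhdsWithin_le_nhds (eventually_le_nhds one_pos)
    obtain ⟨δ, ⟨hδa, hδb⟩, hδpos⟩ := (hev.and self_mem_nhdsWithin).exists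
    exact ⟨δ, hδpos, hδb, hδa⟩
  refine ⟨-δ, by linarith, y₀, ?_⟩
  -- for large `k`: `[-2, 0] ⊂ (A k, B k)`, `‖w k 0 (y k)‖ > 1 - ε/2` and `‖y k - y₀‖ < δ`
  have hk1 : ∀ᶠ k in atTop, A k < -2 := hAlim.eventually (eventually_lt_atBot (-2))
  have hk2 : ∀ᶠ k in atTop, 1 - ε / 2 < ‖w k 0 (y k)‖ :=
    hnearpt.eventually (lt_mem_nhds (by linarith))
  have hk3 : ∀ᶠ k in atTop, dist (y k) y₀ < δ := Metric.tendsto_nhds.1 hy δ hδ0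
  filter_upwards [hk1, hk2, hk3] with k hA hv hyk
  have hslice : ∀ t ∈ Icc (-2 : ℝ) 0, Continuous (w k t) := fun t ht =>
    (hw k).smooth_velocity.continuousOn.comp_continuous (Continuous.prodMk_right t)
      fun x => ⟨⟨hA.trans_le ht.1, ht.2.trans_lt (hBpos k)⟩, mem_univ x⟩
  have hbR : ∀ t ∈ Icc (-2 : ℝ) 0, ∀ x, ‖w k t x‖ ≤ 1 := fun t ht x =>
    hbd k t ⟨hA.trans_le ht.1, ht.2⟩ x
  have hmild : ∀ s t : ℝ, (-2 : ℝ) ≤ s → s < t → t ≤ 0 → ∀ x,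
      w k t x = UnboundedOperators.heatExtension (w k s) (t - s) x - oseenDuhamel 1 s (w k) (w k) t x :=
    fun s t hs hst ht x => hmildAB k s t (hA.trans_le hs) hst (ht.trans_lt (hBpos k)) x
  have hmod := hHold zero_le_one hslice hbR hmild 0 ⟨by norm_num, le_rfl⟩ (-δ)
    ⟨by norm_num; linarith, by linarith⟩ (y k) y₀
  have hmax : max |(-δ) - 0| ‖y₀ - y k‖ = δ := by
    rw [sub_zero, abs_neg, abs_of_pos hδ0]
    refine max_eq_left ?_
    rw [← dist_eq_norm, dist_comm]; exact hyk.le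
  rw [hmax] at hmod
  -- `‖w k (-δ) y₀‖ ≥ ‖w k 0 (y k)‖ − ‖w k (-δ) y₀ − w k 0 (y k)‖ > 1 − ε`
  have htri : ‖w k 0 (y k)‖ ≤ ‖w k (-δ) y₀‖ + ‖w k (-δ) y₀ - w k 0 (y k)‖ := by
    have := norm_add_le (w k (-δ) y₀) (w k 0 (y k) - w k (-δ) y₀)
    rw [add_sub_cancel] at this
    rwa [norm_sub_rev] at this
  linarith

end Literature.Analysis.FluidPDE

end
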